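import Summits.QuantumFields.BalabanUV.T4Continuum.Support.B13ReadingsLineProductsSecond

/-!
# B13ReadingsAvgTowerSecond — row NE5, junction J-avg-reg SECOND ORDER (R60), abstract half, file 2: the SECOND-ORDER FACTORISATION STEP in the
# tower currency — mixed second differences of the straight tower propagate with summable increments; the distance `E = R − S` to the straight
# tower needs, besides `‖E‖ ≤ ρ∕ℓ²`, a FIRST-DIFFERENCE letter `‖E(x+e_ν) − E(x)‖ ≤ ρ₁∕ℓ³`, whose one-step propagation is geometric given a
# first-difference letter `κ₁∕ℓ³` on the one-step correction; and the (ℓ2)-shape letter `hlipD` at level k from these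

Cell `pub-balaban`, unit `b2b-balaban-t4-ne5-p1` (row NE5 OWNER, gen 39; owner item «g39-d», INTENT `HOME/CLAIMS.log` l.24783; RULING R60 l.24769;
GAPS § G-ne5p1-Javg-reg UPDATE 1).  Summits-side NEW WORK under the LEAN PLACEMENT RULE: [folklore] lattice bookkeeping + normed-ring estimates on
the ABSTRACT towers of rows NE2 ∕ B5; 0 `def`, no `Prop`-valued fact, nothing printed asserted, no citation tag.  HONEST FRAMING: rung (B)+1 of the
FINITE-VOLUME T⁴ programme — NOT infinite volume, NOT a mass gap, NOT the Clay problem, NOT a proof of NE5 (NOT PRINTED; GAPS G-t4-U3-1), NOT a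
proof of NE2; the letters below (β″, κ₁, ρ₁) are DISPLAYED — their instances on Bałaban's (0.4) objects (a (3.36)-shape window letter, a
«Stokes for differences» estimate for the correction factors) are nobody's module yet (R60; T4-DAG Q49 (b)).  HONEST DEPENDENCY (cell, verbatim):
continuum YM on T⁴ ⇐ BetaPertH ∧ nine spine estimates (0/9 proved); BetaPertH ⇐ (D1) ∧ (D4) ∧ CAP+tail; G-an2-4 gates asym, D1 and NE2/3/4.

WHAT (ONE STEP; the uniform induction and the END `hlipD` with explicit constants are the NEXT owner item — plan in the lineage records: invariants
`b″_k ≤ e^{4α′D_k}(β″ + 16β′²D_k)`, `ρ₁,k ≤ 4(κ₁ + 9κβ₁)`).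
* §1 `norm_mixed_unit_tstep_le` ∕ `norm_mixed_tstep_tstep_le`: unit mixed second differences `≤ δ₂` ⟹ the `(p, q)`-step mixed second difference
  `≤ p·q·δ₂` (two telescopings).
* §2 `straight_second_of_step`: level-(k+1) straight letters (scaled size `αS`, plain first differences `βS∕ℓ′²`, plain mixed second differences
  `β″∕ℓ′³`) + the straight structure at `i`, `i+e_ν`, `i+e_ν′`, `i+e_ν+e_ν′` ⟹ coarse mixed second difference `≤ e^{αS∕ℓ}(β″ + 2βS²∕ℓ)∕ℓ³`
  (increment `2βS²∕ℓ_k` SUMMABLE ⟹ k-uniform by the file-3 recursion lemmas); `hlipD_of_second_letters`: at level k, straight mixed second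
  differences `≤ b″∕ℓ³` and distance shifts `‖(R − S)(y + e_ν) − (R − S)(y)‖ ≤ ρ₁∕ℓ³` ⟹ **`‖dconnTower R k μ (i + e_ν) − dconnTower R k μ i‖ ≤
  (b″ + 2ρ₁)∕lev L k`** = NE2's `hlipD` binder shape (ℓ2) at that level.
* §3 `dist_shift_of_step`: the `ρ₁` recursion — from level-(k+1) sizes `α`, first differences `β₁`, distance `ρ′`, distance shift `ρ₁′`, the two
  structures, `‖C − 1‖ ≤ κ∕ℓ²` and the NEW correction-shift letter `‖C′ − C‖ ≤ κ₁∕ℓ³`: coarse distance shift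
  `≤ e^{α∕ℓ}(κ₁∕ℓ³ + κβ₁∕ℓ⁴ + 2β₁ρ′∕(Lℓ⁴) + ρ₁′∕(Lℓ³))` — geometric in `ρ₁` (factor `e^{α∕ℓ}∕L`).
0 sorry; axioms ⊆ {propext, Classical.choice, Quot.sound}.
-/

noncomputable section

open scoped BigOperators Matrix Matrix.Norms.L2Operator

namespace Summit.QuantumFields.BalabanUV.T4Continuum.B13ReadingsAvgTowerSecond

open Literature.MathematicalPhysics.QuantumFieldTheory.Balaban1983to89.B5Prop11Plancherel (fine Tor unitVec)
open Literature.MathematicalPhysics.QuantumFieldTheory.Balaban1983to89.B5Block118 (tstep tstep_zero tstep_succ)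
open Literature.MathematicalPhysics.QuantumFieldTheory.Balaban1983to89.B5G183RateUnitTower (lev lev_neZero)
open Summit.QuantumFields.BalabanUV.T4Continuum.BalabanAveragedTowerUnit (idx one_le_lev' cast_lev' lev_succ')
open Summit.QuantumFields.BalabanUV.T4Continuum.BlockPairingGeometry (tau)
open Summit.QuantumFields.BalabanUV.T4Continuum.AbelianCovariantLaplacian (tauInv tau_tauInv tauInv_tau)
open Summit.QuantumFields.BalabanUV.T4Continuum.RegularBackgroundTower (RegularTransporters connTower dconnTower connTower_eq)
open Summit.QuantumFields.BalabanUV.T4Continuum.NE2FromNE3BavgBridge (norm_sub_tstep_le)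
open Summit.QuantumFields.BalabanUV.T4Continuum.B13ReadingsLineProducts (lprod norm_sub_one_le_of_scaled norm_lprod_sub_lprod_le)
open Summit.QuantumFields.BalabanUV.T4Continuum.B13ReadingsLineProductsSecond

/-! ## §1 Lattice telescoping of mixed second differences -/

section Lattice

variable {d : ℕ} {Nf : Fin d → ℕ} {E : Type*} [SeminormedAddCommGroup E]

/-- [folklore] **UNIT × `q` STEPS**: if the unit mixed second differences of a site family are `≤ δ₂`, then the mixed second difference over
one `ν`-step and `q` `ν′`-steps is `≤ q·δ₂`. -/
theorem norm_mixed_unit_tstep_le (F : Tor Nf × Fin d → E) {δ₂ : ℝ}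
    (h2 : ∀ ν ν' (x : Tor Nf) (c : Fin d), ‖F (x + unitVec Nf ν + unitVec Nf ν', c) - F (x + unitVec Nf ν, c) - F (x + unitVec Nf ν', c) + F (x, c)‖ ≤ δ₂)
    (ν ν' : Fin d) (x : Tor Nf) (c : Fin d) :
    ∀ q : ℕ, ‖F (x + unitVec Nf ν + tstep Nf ν' q, c) - F (x + unitVec Nf ν, c) - F (x + tstep Nf ν' q, c) + F (x, c)‖ ≤ q * δ₂
  | 0 => by simp [tstep_zero]
  | q + 1 => by
    have ih := norm_mixed_unit_tstep_le F h2 ν ν' x c q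
    have hstep := h2 ν ν' (x + tstep Nf ν' q) c
    have e1 : x + unitVec Nf ν + tstep Nf ν' (q + 1) = x + unitVec Nf ν + tstep Nf ν' q + unitVec Nf ν' := by rw [tstep_succ, ← add_assoc]
    have e2 : x + tstep Nf ν' (q + 1) = x + tstep Nf ν' q + unitVec Nf ν' := by rw [tstep_succ, add_assoc]
    have e3 : x + tstep Nf ν' q + unitVec Nf ν = x + unitVec Nf ν + tstep Nf ν' q := by abel
    rw [e1, e2]
    rw [e3] at hstep
    calc ‖F (x + unitVec Nf ν + tstep Nf ν' q + unitVec Nf ν', c) - F (x + unitVec Nf ν, c) - F (x + tstep Nf ν' q + unitVec Nf ν', c) + F (x, c)‖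
        = ‖(F (x + unitVec Nf ν + tstep Nf ν' q + unitVec Nf ν', c) - F (x + unitVec Nf ν + tstep Nf ν' q, c)
              - F (x + tstep Nf ν' q + unitVec Nf ν', c) + F (x + tstep Nf ν' q, c))
            + (F (x + unitVec Nf ν + tstep Nf ν' q, c) - F (x + unitVec Nf ν, c) - F (x + tstep Nf ν' q, c) + F (x, c))‖ := by
          congr 1; abel
      _ ≤ δ₂ + q * δ₂ := (norm_add_le _ _).trans (add_le_add hstep ih)
      _ = ((q + 1 : ℕ) : ℝ) * δ₂ := by push_cast; ring

/-- [folklore] **`p` × `q` STEPS**: the mixed second difference over `p` `ν`-steps and `q` `ν′`-steps is `≤ p·q·δ₂`. -/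
theorem norm_mixed_tstep_tstep_le (F : Tor Nf × Fin d → E) {δ₂ : ℝ}
    (h2 : ∀ ν ν' (x : Tor Nf) (c : Fin d), ‖F (x + unitVec Nf ν + unitVec Nf ν', c) - F (x + unitVec Nf ν, c) - F (x + unitVec Nf ν', c) + F (x, c)‖ ≤ δ₂)
    (ν ν' : Fin d) (c : Fin d) (q : ℕ) : ∀ (p : ℕ) (x : Tor Nf),
    ‖F (x + tstep Nf ν p + tstep Nf ν' q, c) - F (x + tstep Nf ν p, c) - F (x + tstep Nf ν' q, c) + F (x, c)‖ ≤ p * q * δ₂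
  | 0, x => by simp [tstep_zero]
  | p + 1, x => by
    have ih := norm_mixed_tstep_tstep_le F h2 ν ν' c q p (x + unitVec Nf ν)
    have h1 := norm_mixed_unit_tstep_le F h2 ν ν' x c q
    have e1 : x + tstep Nf ν (p + 1) = x + unitVec Nf ν + tstep Nf ν p := by rw [tstep_succ]; abel
    rw [e1]
    calc ‖F (x + unitVec Nf ν + tstep Nf ν p + tstep Nf ν' q, c) - F (x + unitVec Nf ν + tstep Nf ν p, c) - F (x + tstep Nf ν' q, c) + F (x, c)‖
        = ‖(F (x + unitVec Nf ν + tstep Nf ν p + tstep Nf ν' q, c) - F (x + unitVec Nf ν + tstep Nf ν p, c)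
              - F (x + unitVec Nf ν + tstep Nf ν' q, c) + F (x + unitVec Nf ν, c))
            + (F (x + unitVec Nf ν + tstep Nf ν' q, c) - F (x + unitVec Nf ν, c) - F (x + tstep Nf ν' q, c) + F (x, c))‖ := by
          congr 1; abel
      _ ≤ p * q * δ₂ + q * δ₂ := (norm_add_le _ _).trans (add_le_add ih h1)
      _ = ((p + 1 : ℕ) : ℝ) * q * δ₂ := by push_cast; ring

end Lattice

/-! ## §2 One step of the second-order factorisation at a coarse index -/

section Tower

variable {d : ℕ} (L : ℕ) [NeZero L] (M : Fin d → ℕ) [hM : ∀ μ, NeZero (M μ)]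
variable {o : Type*} [Fintype o] [DecidableEq o]
variable {R S : (k : ℕ) → Fin d → (idx L M k → Matrix o o ℂ)}

omit hM in
/-- [folklore] **STRAIGHT SECOND-ORDER STEP.**  Level-`(k+1)` letters of the straight parts `S (k+1) μ` (scaled size `≤ αS`, plain first
differences `≤ βS∕ℓ′∕ℓ′`, plain MIXED second differences `≤ β″∕ℓ′³`) and the straight structure at the four coarse indices `i`, `i + e_ν`,
`i + e_ν′`, `i + e_ν + e_ν′` (lines starting at `s`, `s + L e_ν`, `s + L e_ν′`, `s + L e_ν + L e_ν′`) give the coarse mixed second difference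
`≤ e^{αS∕ℓ}·(β″ + 2βS²∕ℓ)∕ℓ³` — the increment `2βS²∕ℓ_k` is SUMMABLE down the tower. -/
theorem straight_second_of_step {k : ℕ} {μ ν ν' : Fin d} {i : idx L M k} {s : Tor (fine (L * lev L k) M)} {αS βS β₂ : ℝ}
    (hSsize : ∀ y : Tor (fine (L * lev L k) M) × Fin d, ‖((L * lev L k : ℕ) : ℂ) • (S (k + 1) μ y - 1)‖ ≤ αS)
    (hSlip : ∀ (ν₁ : Fin d) (y : Tor (fine (L * lev L k) M) × Fin d),
      ‖S (k + 1) μ (tau (fine (L * lev L k) M) ν₁ y) - S (k + 1) μ y‖ ≤ βS / ((L * lev L k : ℕ) : ℝ) / ((L * lev L k : ℕ) : ℝ))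
    (hS2 : ∀ (ν₁ ν₂ : Fin d) (x : Tor (fine (L * lev L k) M)) (c : Fin d),
      ‖S (k + 1) μ (x + unitVec _ ν₁ + unitVec _ ν₂, c) - S (k + 1) μ (x + unitVec _ ν₁, c) - S (k + 1) μ (x + unitVec _ ν₂, c) + S (k + 1) μ (x, c)‖
        ≤ β₂ / ((L * lev L k : ℕ) : ℝ) ^ 3)
    (hS00 : S k μ i = lprod (fun t => S (k + 1) μ (s + tstep (fine (L * lev L k) M) μ t, i.2)) L)
    (hS10 : S k μ (tau (fine (lev L k) M) ν i) = lprod (fun t => S (k + 1) μ (s + tstep (fine (L * lev L k) M) ν L + tstep (fine (L * lev L k) M) μ t, i.2)) L)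
    (hS01 : S k μ (tau (fine (lev L k) M) ν' i) = lprod (fun t => S (k + 1) μ (s + tstep (fine (L * lev L k) M) ν' L + tstep (fine (L * lev L k) M) μ t, i.2)) L)
    (hS11 : S k μ (tau (fine (lev L k) M) ν (tau (fine (lev L k) M) ν' i))
      = lprod (fun t => S (k + 1) μ (s + tstep (fine (L * lev L k) M) ν L + tstep (fine (L * lev L k) M) ν' L + tstep (fine (L * lev L k) M) μ t, i.2)) L) :
    ‖S k μ (tau (fine (lev L k) M) ν (tau (fine (lev L k) M) ν' i)) - S k μ (tau (fine (lev L k) M) ν i) - S k μ (tau (fine (lev L k) M) ν' i) + S k μ i‖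
      ≤ Real.exp (αS / (lev L k : ℕ)) * (β₂ + 2 * βS ^ 2 / (lev L k : ℕ)) / ((lev L k : ℕ) : ℝ) ^ 3 := by
  have hL : 0 < L := Nat.pos_of_ne_zero (NeZero.ne L)
  have hLr : (0 : ℝ) < L := by exact_mod_cast hL
  have hℓ : (0 : ℝ) < (lev L k : ℕ) := by exact_mod_cast one_le_lev' L k
  have hℓ'nat : 0 < L * lev L k := Nat.mul_pos hL (one_le_lev' L k)
  have hℓ' : (0 : ℝ) < ((L * lev L k : ℕ) : ℝ) := by exact_mod_cast hℓ'nat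
  have hℓ'eq : ((L * lev L k : ℕ) : ℝ) = L * (lev L k : ℕ) := by rw [Nat.cast_mul]
  -- plain size of every fine straight part
  have he : ∀ y : Tor (fine (L * lev L k) M) × Fin d, ‖S (k + 1) μ y - 1‖ ≤ αS / ((L * lev L k : ℕ) : ℝ) :=
    fun y => norm_sub_one_le_of_scaled hℓ'nat (hSsize y)
  -- translation by `L` fine steps: first differences `≤ L·βS/ℓ′²`, mixed second differences `≤ L²·β″/ℓ′³`
  have hδ : ∀ (ν₁ : Fin d) (x : Tor (fine (L * lev L k) M)) (c : Fin d), ‖S (k + 1) μ (x + tstep (fine (L * lev L k) M) ν₁ L, c) - S (k + 1) μ (x, c)‖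
      ≤ L * (βS / ((L * lev L k : ℕ) : ℝ) / ((L * lev L k : ℕ) : ℝ)) := fun ν₁ x c => norm_sub_tstep_le (S (k + 1) μ) hSlip x c ν₁ L
  have hδ2 : ∀ (x : Tor (fine (L * lev L k) M)) (c : Fin d), ‖S (k + 1) μ (x + tstep (fine (L * lev L k) M) ν L + tstep (fine (L * lev L k) M) ν' L, c) - S (k + 1) μ (x + tstep (fine (L * lev L k) M) ν L, c)
      - S (k + 1) μ (x + tstep (fine (L * lev L k) M) ν' L, c) + S (k + 1) μ (x, c)‖ ≤ L * L * (β₂ / ((L * lev L k : ℕ) : ℝ) ^ 3) :=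
    fun x c => norm_mixed_tstep_tstep_le (S (k + 1) μ) hS2 ν ν' c L L x
  have hfg : ∀ t < L, ‖S (k + 1) μ (s + tstep (fine (L * lev L k) M) μ t, i.2) - S (k + 1) μ (s + tstep (fine (L * lev L k) M) ν L + tstep (fine (L * lev L k) M) μ t, i.2)‖
      ≤ L * (βS / ((L * lev L k : ℕ) : ℝ) / ((L * lev L k : ℕ) : ℝ)) := fun t _ => by
    rw [show s + tstep (fine (L * lev L k) M) ν L + tstep (fine (L * lev L k) M) μ t = s + tstep (fine (L * lev L k) M) μ t + tstep (fine (L * lev L k) M) ν L by abel, norm_sub_rev]; exact hδ ν _ i.2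
  have hfh : ∀ t < L, ‖S (k + 1) μ (s + tstep (fine (L * lev L k) M) μ t, i.2) - S (k + 1) μ (s + tstep (fine (L * lev L k) M) ν' L + tstep (fine (L * lev L k) M) μ t, i.2)‖
      ≤ L * (βS / ((L * lev L k : ℕ) : ℝ) / ((L * lev L k : ℕ) : ℝ)) := fun t _ => by
    rw [show s + tstep (fine (L * lev L k) M) ν' L + tstep (fine (L * lev L k) M) μ t = s + tstep (fine (L * lev L k) M) μ t + tstep (fine (L * lev L k) M) ν' L by abel, norm_sub_rev]; exact hδ ν' _ i.2
  have hgm : ∀ t < L, ‖S (k + 1) μ (s + tstep (fine (L * lev L k) M) ν L + tstep (fine (L * lev L k) M) μ t, i.2) - S (k + 1) μ (s + tstep (fine (L * lev L k) M) ν L + tstep (fine (L * lev L k) M) ν' L + tstep (fine (L * lev L k) M) μ t, i.2)‖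
      ≤ L * (βS / ((L * lev L k : ℕ) : ℝ) / ((L * lev L k : ℕ) : ℝ)) := fun t _ => by
    rw [show s + tstep (fine (L * lev L k) M) ν L + tstep (fine (L * lev L k) M) ν' L + tstep (fine (L * lev L k) M) μ t = s + tstep (fine (L * lev L k) M) ν L + tstep (fine (L * lev L k) M) μ t + tstep (fine (L * lev L k) M) ν' L by abel, norm_sub_rev]
    exact hδ ν' _ i.2
  have h22 : ∀ t < L, ‖S (k + 1) μ (s + tstep (fine (L * lev L k) M) ν L + tstep (fine (L * lev L k) M) ν' L + tstep (fine (L * lev L k) M) μ t, i.2) - S (k + 1) μ (s + tstep (fine (L * lev L k) M) ν L + tstep (fine (L * lev L k) M) μ t, i.2)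
      - S (k + 1) μ (s + tstep (fine (L * lev L k) M) ν' L + tstep (fine (L * lev L k) M) μ t, i.2) + S (k + 1) μ (s + tstep (fine (L * lev L k) M) μ t, i.2)‖ ≤ L * L * (β₂ / ((L * lev L k : ℕ) : ℝ) ^ 3) := fun t _ => by
    have e1 : s + tstep (fine (L * lev L k) M) ν L + tstep (fine (L * lev L k) M) ν' L + tstep (fine (L * lev L k) M) μ t = s + tstep (fine (L * lev L k) M) μ t + tstep (fine (L * lev L k) M) ν L + tstep (fine (L * lev L k) M) ν' L := by abel
    have e2 : s + tstep (fine (L * lev L k) M) ν L + tstep (fine (L * lev L k) M) μ t = s + tstep (fine (L * lev L k) M) μ t + tstep (fine (L * lev L k) M) ν L := by abel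
    have e3 : s + tstep (fine (L * lev L k) M) ν' L + tstep (fine (L * lev L k) M) μ t = s + tstep (fine (L * lev L k) M) μ t + tstep (fine (L * lev L k) M) ν' L := by abel
    rw [e1, e2, e3]; exact hδ2 _ i.2
  have hmain := norm_lprod_second_diff_le (n := L)
    (f := fun t => S (k + 1) μ (s + tstep (fine (L * lev L k) M) μ t, i.2))
    (g := fun t => S (k + 1) μ (s + tstep (fine (L * lev L k) M) ν L + tstep (fine (L * lev L k) M) μ t, i.2))
    (h := fun t => S (k + 1) μ (s + tstep (fine (L * lev L k) M) ν' L + tstep (fine (L * lev L k) M) μ t, i.2))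
    (m := fun t => S (k + 1) μ (s + tstep (fine (L * lev L k) M) ν L + tstep (fine (L * lev L k) M) ν' L + tstep (fine (L * lev L k) M) μ t, i.2))
    (fun t _ => he _) (fun t _ => he _) (fun t _ => he _) (fun t _ => he _) hfg hfh hgm h22
  rw [hS11, hS10, hS01, hS00]
  refine hmain.trans ?_
  -- arithmetic: `(1 + αS/ℓ′)^L·(2L²·(LβS/ℓ′²)² + L·L²β″/ℓ′³) ≤ e^{αS/ℓ}(β″ + 2βS²/ℓ)/ℓ³`
  have hαS : 0 ≤ αS := (norm_nonneg _).trans (hSsize (s, i.2))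
  have hpow : (1 + αS / ((L * lev L k : ℕ) : ℝ)) ^ L ≤ Real.exp (αS / (lev L k : ℕ)) := by
    calc (1 + αS / ((L * lev L k : ℕ) : ℝ)) ^ L ≤ (Real.exp (αS / ((L * lev L k : ℕ) : ℝ))) ^ L :=
          pow_le_pow_left₀ (by positivity) (by rw [add_comm]; exact Real.add_one_le_exp _) L
      _ = Real.exp (L * (αS / ((L * lev L k : ℕ) : ℝ))) := by rw [← Real.exp_nat_mul]
      _ = Real.exp (αS / (lev L k : ℕ)) := by congr 1; rw [hℓ'eq]; field_simp
  have hβS2 : 0 ≤ βS ^ 2 := sq_nonneg _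
  have hβ2 : 0 ≤ β₂ := by
    have h0 := (norm_nonneg _).trans (hS2 ν ν' s i.2)
    rw [le_div_iff₀ (by positivity), zero_mul] at h0
    exact h0
  have heq : (2 * (L : ℝ) ^ 2 * (L * (βS / ((L * lev L k : ℕ) : ℝ) / ((L * lev L k : ℕ) : ℝ))) * (L * (βS / ((L * lev L k : ℕ) : ℝ) / ((L * lev L k : ℕ) : ℝ)))
        + L * (L * L * (β₂ / ((L * lev L k : ℕ) : ℝ) ^ 3)))
      = (β₂ + 2 * βS ^ 2 / (lev L k : ℕ)) / ((lev L k : ℕ) : ℝ) ^ 3 := by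
    rw [hℓ'eq]; field_simp; ring
  rw [heq]
  have hnum : 0 ≤ (β₂ + 2 * βS ^ 2 / (lev L k : ℕ)) / ((lev L k : ℕ) : ℝ) ^ 3 := by positivity
  calc (1 + αS / ((L * lev L k : ℕ) : ℝ)) ^ L * ((β₂ + 2 * βS ^ 2 / (lev L k : ℕ)) / ((lev L k : ℕ) : ℝ) ^ 3)
      ≤ Real.exp (αS / (lev L k : ℕ)) * ((β₂ + 2 * βS ^ 2 / (lev L k : ℕ)) / ((lev L k : ℕ) : ℝ) ^ 3) :=
        mul_le_mul_of_nonneg_right hpow hnum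
    _ = Real.exp (αS / (lev L k : ℕ)) * (β₂ + 2 * βS ^ 2 / (lev L k : ℕ)) / ((lev L k : ℕ) : ℝ) ^ 3 := by ring

omit hM in
/-- [folklore] **(ℓ2) AT LEVEL `k` FROM THE LEVEL-`k` LETTERS**: if the straight tower has mixed second differences `≤ b″∕ℓ_k³` and the distance
`E = R − S` has first differences `≤ ρ₁∕ℓ_k³` (both plain, at level `k`), then the derivative tower of `R` is lattice-Lipschitz with
`βD = b″ + 2ρ₁`: `‖dconnTower R k μ (i + e_ν) − dconnTower R k μ i‖ ≤ (b″ + 2ρ₁)∕lev L k` — EXACTLY the `hlipD` binder shape of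
`NE2FromNE3BavgBridge.localRate_regClass_of_bavg_consistent`. -/
theorem hlipD_of_second_letters {k : ℕ} {b₂ ρ₁ : ℝ}
    (hS2 : ∀ (μ ν ν' : Fin d) (x : Tor (fine (lev L k) M)) (c : Fin d),
      ‖S k μ (x + unitVec _ ν + unitVec _ ν', c) - S k μ (x + unitVec _ ν, c) - S k μ (x + unitVec _ ν', c) + S k μ (x, c)‖
        ≤ b₂ / ((lev L k : ℕ) : ℝ) ^ 3)
    (hE1 : ∀ (μ ν : Fin d) (y : idx L M k),
      ‖(R k μ (tau (fine (lev L k) M) ν y) - S k μ (tau (fine (lev L k) M) ν y)) - (R k μ y - S k μ y)‖ ≤ ρ₁ / ((lev L k : ℕ) : ℝ) ^ 3)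
    (μ ν : Fin d) (i : idx L M k) :
    ‖dconnTower L M R k μ (tau (fine (lev L k) M) ν i) - dconnTower L M R k μ i‖ ≤ (b₂ + 2 * ρ₁) / (lev L k : ℕ) := by
  have hℓ1 : (1 : ℝ) ≤ (lev L k : ℕ) := by exact_mod_cast one_le_lev' L k
  have hℓ : (0 : ℝ) < (lev L k : ℕ) := by linarith
  -- the base point `j = τ_μ⁻¹ i`: the four points are `j`, `j + e_μ = i`, `j + e_ν`, `j + e_μ + e_ν = τ_ν i`
  obtain ⟨x, c⟩ := i
  set y : Tor (fine (lev L k) M) := x - unitVec (fine (lev L k) M) μ with hy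
  have hx : x = y + unitVec (fine (lev L k) M) μ := by rw [hy, sub_add_cancel]
  -- expand the derivative tower: `dconnTower = ℓ²•(R − R∘τ⁻¹)`
  have hd : ∀ z : idx L M k, dconnTower L M R k μ z
      = (((lev L k : ℕ) : ℂ) * ((lev L k : ℕ) : ℂ)) • (R k μ z - R k μ (tauInv (fine (lev L k) M) μ z)) := by
    intro z
    rw [dconnTower, connTower_eq, connTower_eq, ← smul_sub, sub_sub_sub_cancel_right, smul_smul]
  have h1 : tauInv (fine (lev L k) M) μ (tau (fine (lev L k) M) ν (x, c)) = (y + unitVec (fine (lev L k) M) ν, c) := by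
    change (x + unitVec (fine (lev L k) M) ν - unitVec (fine (lev L k) M) μ, c) = _
    rw [hx]; congr 1; abel
  have h2 : tauInv (fine (lev L k) M) μ (x, c) = (y, c) := rfl
  have h3 : tau (fine (lev L k) M) ν (x, c) = (y + unitVec (fine (lev L k) M) μ + unitVec (fine (lev L k) M) ν, c) := by
    change (x + unitVec (fine (lev L k) M) ν, c) = _
    rw [hx]
  rw [hd, hd, ← smul_sub, h1, h2, h3, hx, norm_smul, norm_mul, Complex.norm_natCast]
  -- the second difference of `R = S + E`
  have hS := hS2 μ μ ν y c
  have hE : ‖(R k μ (y + unitVec (fine (lev L k) M) ν, c) - S k μ (y + unitVec (fine (lev L k) M) ν, c)) - (R k μ (y, c) - S k μ (y, c))‖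
      ≤ ρ₁ / ((lev L k : ℕ) : ℝ) ^ 3 := hE1 μ ν (y, c)
  have hE' : ‖(R k μ (y + unitVec (fine (lev L k) M) μ + unitVec (fine (lev L k) M) ν, c)
        - S k μ (y + unitVec (fine (lev L k) M) μ + unitVec (fine (lev L k) M) ν, c))
        - (R k μ (y + unitVec (fine (lev L k) M) μ, c) - S k μ (y + unitVec (fine (lev L k) M) μ, c))‖ ≤ ρ₁ / ((lev L k : ℕ) : ℝ) ^ 3 :=
    hE1 μ ν (y + unitVec (fine (lev L k) M) μ, c)
  have key : R k μ (y + unitVec (fine (lev L k) M) μ + unitVec (fine (lev L k) M) ν, c) - R k μ (y + unitVec (fine (lev L k) M) ν, c)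
        - (R k μ (y + unitVec (fine (lev L k) M) μ, c) - R k μ (y, c))
      = (S k μ (y + unitVec (fine (lev L k) M) μ + unitVec (fine (lev L k) M) ν, c) - S k μ (y + unitVec (fine (lev L k) M) μ, c)
          - S k μ (y + unitVec (fine (lev L k) M) ν, c) + S k μ (y, c))
        + ((R k μ (y + unitVec (fine (lev L k) M) μ + unitVec (fine (lev L k) M) ν, c)
              - S k μ (y + unitVec (fine (lev L k) M) μ + unitVec (fine (lev L k) M) ν, c))
            - (R k μ (y + unitVec (fine (lev L k) M) μ, c) - S k μ (y + unitVec (fine (lev L k) M) μ, c)))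
        - ((R k μ (y + unitVec (fine (lev L k) M) ν, c) - S k μ (y + unitVec (fine (lev L k) M) ν, c)) - (R k μ (y, c) - S k μ (y, c))) := by
    abel
  have hnorm : ‖R k μ (y + unitVec (fine (lev L k) M) μ + unitVec (fine (lev L k) M) ν, c) - R k μ (y + unitVec (fine (lev L k) M) ν, c)
        - (R k μ (y + unitVec (fine (lev L k) M) μ, c) - R k μ (y, c))‖
      ≤ b₂ / ((lev L k : ℕ) : ℝ) ^ 3 + ρ₁ / ((lev L k : ℕ) : ℝ) ^ 3 + ρ₁ / ((lev L k : ℕ) : ℝ) ^ 3 := by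
    rw [key]
    exact (norm_sub_le _ _).trans (add_le_add ((norm_add_le _ _).trans (add_le_add hS hE')) hE)
  calc ((lev L k : ℕ) : ℝ) * (lev L k : ℕ) * ‖R k μ (y + unitVec (fine (lev L k) M) μ + unitVec (fine (lev L k) M) ν, c)
          - R k μ (y + unitVec (fine (lev L k) M) ν, c) - (R k μ (y + unitVec (fine (lev L k) M) μ, c) - R k μ (y, c))‖
      ≤ ((lev L k : ℕ) : ℝ) * (lev L k : ℕ) * (b₂ / ((lev L k : ℕ) : ℝ) ^ 3 + ρ₁ / ((lev L k : ℕ) : ℝ) ^ 3 + ρ₁ / ((lev L k : ℕ) : ℝ) ^ 3) :=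
        mul_le_mul_of_nonneg_left hnorm (by positivity)
    _ = (b₂ + 2 * ρ₁) / (lev L k : ℕ) := by field_simp; ring

omit hM in
/-- [folklore] **DISTANCE-SHIFT STEP (the `ρ₁` recursion).**  For the distance `E = R − S` to the straight tower: from the level-`(k+1)` letters
along the two lines at `s` and `s + L e_ν` — sizes `≤ α` (scaled, both towers), plain first differences `≤ β₁∕ℓ′∕ℓ′` (both towers), distance
`‖R − S‖ ≤ ρ′∕ℓ′²`, distance SHIFT `‖(R − S)(y + e) − (R − S)(y)‖ ≤ ρ₁′∕ℓ′³` — the structures, the correction letter `‖C − 1‖ ≤ κ∕ℓ²` and the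
correction SHIFT letter `‖C′ − C‖ ≤ κ₁∕ℓ³` (NEW, displayed; for Bałaban's (0.4) a «Stokes for differences» estimate): the coarse distance shift is
`≤ e^{α∕ℓ}·(κ₁∕ℓ³ + κβ₁∕ℓ⁴ + 2β₁ρ′∕(Lℓ⁴) + ρ₁′∕(Lℓ³))` — GEOMETRIC in `ρ₁` (factor `e^{α∕ℓ}∕L`) with summable additive terms. -/
theorem dist_shift_of_step {k : ℕ} {μ ν : Fin d} {i : idx L M k} {C C' : Matrix o o ℂ} {s : Tor (fine (L * lev L k) M)} {α β₁ κ κ₁ ρ' ρ₁' : ℝ}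
    (hRsize : ∀ y : Tor (fine (L * lev L k) M) × Fin d, ‖((L * lev L k : ℕ) : ℂ) • (R (k + 1) μ y - 1)‖ ≤ α)
    (hSsize : ∀ y : Tor (fine (L * lev L k) M) × Fin d, ‖((L * lev L k : ℕ) : ℂ) • (S (k + 1) μ y - 1)‖ ≤ α)
    (hRlip : ∀ (ν₁ : Fin d) (y : Tor (fine (L * lev L k) M) × Fin d), ‖R (k + 1) μ (tau (fine (L * lev L k) M) ν₁ y) - R (k + 1) μ y‖ ≤ β₁ / ((L * lev L k : ℕ) : ℝ) / ((L * lev L k : ℕ) : ℝ))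
    (hSlip : ∀ (ν₁ : Fin d) (y : Tor (fine (L * lev L k) M) × Fin d), ‖S (k + 1) μ (tau (fine (L * lev L k) M) ν₁ y) - S (k + 1) μ y‖ ≤ β₁ / ((L * lev L k : ℕ) : ℝ) / ((L * lev L k : ℕ) : ℝ))
    (hdist : ∀ y : Tor (fine (L * lev L k) M) × Fin d, ‖R (k + 1) μ y - S (k + 1) μ y‖ ≤ ρ' / ((L * lev L k : ℕ) : ℝ) ^ 2)
    (hshift : ∀ (ν₁ : Fin d) (y : Tor (fine (L * lev L k) M) × Fin d),
      ‖(R (k + 1) μ (tau (fine (L * lev L k) M) ν₁ y) - S (k + 1) μ (tau (fine (L * lev L k) M) ν₁ y)) - (R (k + 1) μ y - S (k + 1) μ y)‖ ≤ ρ₁' / ((L * lev L k : ℕ) : ℝ) ^ 3)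
    (hR0 : R k μ i = C * lprod (fun t => R (k + 1) μ (s + tstep (fine (L * lev L k) M) μ t, i.2)) L)
    (hR1 : R k μ (tau (fine (lev L k) M) ν i) = C' * lprod (fun t => R (k + 1) μ (s + tstep (fine (L * lev L k) M) ν L + tstep (fine (L * lev L k) M) μ t, i.2)) L)
    (hS0 : S k μ i = lprod (fun t => S (k + 1) μ (s + tstep (fine (L * lev L k) M) μ t, i.2)) L)
    (hS1 : S k μ (tau (fine (lev L k) M) ν i) = lprod (fun t => S (k + 1) μ (s + tstep (fine (L * lev L k) M) ν L + tstep (fine (L * lev L k) M) μ t, i.2)) L)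
    (hC : ‖C - 1‖ ≤ κ / ((lev L k : ℕ) : ℝ) ^ 2) (hCC : ‖C' - C‖ ≤ κ₁ / ((lev L k : ℕ) : ℝ) ^ 3) :
    ‖(R k μ (tau (fine (lev L k) M) ν i) - S k μ (tau (fine (lev L k) M) ν i)) - (R k μ i - S k μ i)‖
      ≤ Real.exp (α / (lev L k : ℕ)) * (κ₁ / ((lev L k : ℕ) : ℝ) ^ 3 + κ * β₁ / ((lev L k : ℕ) : ℝ) ^ 4
          + 2 * β₁ * ρ' / (L * ((lev L k : ℕ) : ℝ) ^ 4) + ρ₁' / (L * ((lev L k : ℕ) : ℝ) ^ 3)) := by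
  have hL : 0 < L := Nat.pos_of_ne_zero (NeZero.ne L)
  have hLr : (0 : ℝ) < L := by exact_mod_cast hL
  have hℓ : (0 : ℝ) < (lev L k : ℕ) := by exact_mod_cast one_le_lev' L k
  have hℓ'nat : 0 < L * lev L k := Nat.mul_pos hL (one_le_lev' L k)
  have hℓ' : (0 : ℝ) < ((L * lev L k : ℕ) : ℝ) := by exact_mod_cast hℓ'nat
  have hℓ'eq : ((L * lev L k : ℕ) : ℝ) = L * (lev L k : ℕ) := by rw [Nat.cast_mul]
  have hα : 0 ≤ α := (norm_nonneg _).trans (hRsize (s, i.2))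
  have hκ : 0 ≤ κ := by have h0 := (norm_nonneg _).trans hC; rw [le_div_iff₀ (by positivity), zero_mul] at h0; exact h0
  have hκ₁ : 0 ≤ κ₁ := by have h0 := (norm_nonneg _).trans hCC; rw [le_div_iff₀ (by positivity), zero_mul] at h0; exact h0
  -- plain sizes
  have heR : ∀ y : Tor (fine (L * lev L k) M) × Fin d, ‖R (k + 1) μ y - 1‖ ≤ α / ((L * lev L k : ℕ) : ℝ) := fun y => norm_sub_one_le_of_scaled hℓ'nat (hRsize y)
  have heS : ∀ y : Tor (fine (L * lev L k) M) × Fin d, ‖S (k + 1) μ y - 1‖ ≤ α / ((L * lev L k : ℕ) : ℝ) := fun y => norm_sub_one_le_of_scaled hℓ'nat (hSsize y)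
  have hpow : (1 + α / ((L * lev L k : ℕ) : ℝ)) ^ L ≤ Real.exp (α / (lev L k : ℕ)) := by
    calc (1 + α / ((L * lev L k : ℕ) : ℝ)) ^ L ≤ (Real.exp (α / ((L * lev L k : ℕ) : ℝ))) ^ L :=
          pow_le_pow_left₀ (by positivity) (by rw [add_comm]; exact Real.add_one_le_exp _) L
      _ = Real.exp (L * (α / ((L * lev L k : ℕ) : ℝ))) := by rw [← Real.exp_nat_mul]
      _ = Real.exp (α / (lev L k : ℕ)) := by congr 1; rw [hℓ'eq]; field_simp
  -- L-step translation bounds along the line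
  have hδR : ∀ t < L, ‖R (k + 1) μ (s + tstep (fine (L * lev L k) M) μ t, i.2) - R (k + 1) μ (s + tstep (fine (L * lev L k) M) ν L + tstep (fine (L * lev L k) M) μ t, i.2)‖
      ≤ L * (β₁ / ((L * lev L k : ℕ) : ℝ) / ((L * lev L k : ℕ) : ℝ)) := fun t _ => by
    rw [show s + tstep (fine (L * lev L k) M) ν L + tstep (fine (L * lev L k) M) μ t = s + tstep (fine (L * lev L k) M) μ t + tstep (fine (L * lev L k) M) ν L by abel, norm_sub_rev]
    exact norm_sub_tstep_le (R (k + 1) μ) hRlip _ i.2 ν L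
  have hδS : ∀ t < L, ‖S (k + 1) μ (s + tstep (fine (L * lev L k) M) μ t, i.2) - S (k + 1) μ (s + tstep (fine (L * lev L k) M) ν L + tstep (fine (L * lev L k) M) μ t, i.2)‖
      ≤ L * (β₁ / ((L * lev L k : ℕ) : ℝ) / ((L * lev L k : ℕ) : ℝ)) := fun t _ => by
    rw [show s + tstep (fine (L * lev L k) M) ν L + tstep (fine (L * lev L k) M) μ t = s + tstep (fine (L * lev L k) M) μ t + tstep (fine (L * lev L k) M) ν L by abel, norm_sub_rev]
    exact norm_sub_tstep_le (S (k + 1) μ) hSlip _ i.2 ν L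
  have hshL : ∀ t < L, ‖R (k + 1) μ (s + tstep (fine (L * lev L k) M) ν L + tstep (fine (L * lev L k) M) μ t, i.2) - S (k + 1) μ (s + tstep (fine (L * lev L k) M) ν L + tstep (fine (L * lev L k) M) μ t, i.2)
      - R (k + 1) μ (s + tstep (fine (L * lev L k) M) μ t, i.2) + S (k + 1) μ (s + tstep (fine (L * lev L k) M) μ t, i.2)‖ ≤ L * (ρ₁' / ((L * lev L k : ℕ) : ℝ) ^ 3) := fun t _ => by
    have h := norm_sub_tstep_le (fun y => R (k + 1) μ y - S (k + 1) μ y) hshift (s + tstep (fine (L * lev L k) M) μ t) i.2 ν L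
    rw [show s + tstep (fine (L * lev L k) M) ν L + tstep (fine (L * lev L k) M) μ t = s + tstep (fine (L * lev L k) M) μ t + tstep (fine (L * lev L k) M) ν L by abel]
    have e : R (k + 1) μ (s + tstep (fine (L * lev L k) M) μ t + tstep (fine (L * lev L k) M) ν L, i.2) - S (k + 1) μ (s + tstep (fine (L * lev L k) M) μ t + tstep (fine (L * lev L k) M) ν L, i.2)
        - R (k + 1) μ (s + tstep (fine (L * lev L k) M) μ t, i.2) + S (k + 1) μ (s + tstep (fine (L * lev L k) M) μ t, i.2)
        = (R (k + 1) μ (s + tstep (fine (L * lev L k) M) μ t + tstep (fine (L * lev L k) M) ν L, i.2) - S (k + 1) μ (s + tstep (fine (L * lev L k) M) μ t + tstep (fine (L * lev L k) M) ν L, i.2))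
          - (R (k + 1) μ (s + tstep (fine (L * lev L k) M) μ t, i.2) - S (k + 1) μ (s + tstep (fine (L * lev L k) M) μ t, i.2)) := by abel
    rw [e]; exact h
  -- the three pieces
  have hfifth := norm_lprod_diff_shift_le (n := L)
    (f := fun t => R (k + 1) μ (s + tstep (fine (L * lev L k) M) μ t, i.2)) (g := fun t => S (k + 1) μ (s + tstep (fine (L * lev L k) M) μ t, i.2))
    (f' := fun t => R (k + 1) μ (s + tstep (fine (L * lev L k) M) ν L + tstep (fine (L * lev L k) M) μ t, i.2)) (g' := fun t => S (k + 1) μ (s + tstep (fine (L * lev L k) M) ν L + tstep (fine (L * lev L k) M) μ t, i.2))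
    (fun t _ => heR _) (fun t _ => heS _) (fun t _ => heR _) (fun t _ => heS _) (fun t _ => hdist _) hδR hδS hshL
  have hPR := norm_lprod_sub_lprod_le (n := L) (f := fun t => R (k + 1) μ (s + tstep (fine (L * lev L k) M) ν L + tstep (fine (L * lev L k) M) μ t, i.2))
    (g := fun t => R (k + 1) μ (s + tstep (fine (L * lev L k) M) μ t, i.2)) (fun t _ => heR _) (fun t _ => heR _)
  have hPR1 := norm_lprod_sub_one_add_one_le (n := L) (g := fun t => R (k + 1) μ (s + tstep (fine (L * lev L k) M) ν L + tstep (fine (L * lev L k) M) μ t, i.2)) (fun t _ => heR _)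
  set PR := lprod (fun t => R (k + 1) μ (s + tstep (fine (L * lev L k) M) μ t, i.2)) L
  set PR' := lprod (fun t => R (k + 1) μ (s + tstep (fine (L * lev L k) M) ν L + tstep (fine (L * lev L k) M) μ t, i.2)) L
  set PS := lprod (fun t => S (k + 1) μ (s + tstep (fine (L * lev L k) M) μ t, i.2)) L
  set PS' := lprod (fun t => S (k + 1) μ (s + tstep (fine (L * lev L k) M) ν L + tstep (fine (L * lev L k) M) μ t, i.2)) L
  have hsum : ∑ t ∈ Finset.range L, ‖R (k + 1) μ (s + tstep (fine (L * lev L k) M) ν L + tstep (fine (L * lev L k) M) μ t, i.2) - R (k + 1) μ (s + tstep (fine (L * lev L k) M) μ t, i.2)‖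
      ≤ L * (L * (β₁ / ((L * lev L k : ℕ) : ℝ) / ((L * lev L k : ℕ) : ℝ))) := by
    calc ∑ t ∈ Finset.range L, ‖R (k + 1) μ (s + tstep (fine (L * lev L k) M) ν L + tstep (fine (L * lev L k) M) μ t, i.2) - R (k + 1) μ (s + tstep (fine (L * lev L k) M) μ t, i.2)‖
        ≤ ∑ _t ∈ Finset.range L, L * (β₁ / ((L * lev L k : ℕ) : ℝ) / ((L * lev L k : ℕ) : ℝ)) :=
          Finset.sum_le_sum fun t ht => by rw [norm_sub_rev]; exact hδR t (Finset.mem_range.1 ht)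
      _ = L * (L * (β₁ / ((L * lev L k : ℕ) : ℝ) / ((L * lev L k : ℕ) : ℝ))) := by rw [Finset.sum_const, Finset.card_range, nsmul_eq_mul]
  rw [hR1, hS1, hR0, hS0]
  have hring : C' * PR' - PS' - (C * PR - PS) = ((C' - C) * (PR' - 1) + (C' - C)) + (C - 1) * (PR' - PR) + (PR' - PS' - PR + PS) := by
    noncomm_ring
  rw [hring]
  have hE := Real.exp_pos (α / (lev L k : ℕ))
  have hexp1 : 1 ≤ Real.exp (α / (lev L k : ℕ)) := Real.one_le_exp (by positivity)
  calc ‖((C' - C) * (PR' - 1) + (C' - C)) + (C - 1) * (PR' - PR) + (PR' - PS' - PR + PS)‖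
      ≤ (‖C' - C‖ * ‖PR' - 1‖ + ‖C' - C‖) + ‖C - 1‖ * ‖PR' - PR‖ + ‖PR' - PS' - PR + PS‖ :=
        (norm_add_le _ _).trans (add_le_add ((norm_add_le _ _).trans (add_le_add ((norm_add_le _ _).trans
          (add_le_add (norm_mul_le _ _) le_rfl)) (norm_mul_le _ _))) le_rfl)
    _ = ‖C' - C‖ * (‖PR' - 1‖ + 1) + ‖C - 1‖ * ‖PR' - PR‖ + ‖PR' - PS' - PR + PS‖ := by ring
    _ ≤ κ₁ / ((lev L k : ℕ) : ℝ) ^ 3 * Real.exp (α / (lev L k : ℕ))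
        + κ / ((lev L k : ℕ) : ℝ) ^ 2 * (Real.exp (α / (lev L k : ℕ)) * (L * (L * (β₁ / ((L * lev L k : ℕ) : ℝ) / ((L * lev L k : ℕ) : ℝ)))))
        + Real.exp (α / (lev L k : ℕ)) * (2 * (L : ℝ) ^ 2 * (L * (β₁ / ((L * lev L k : ℕ) : ℝ) / ((L * lev L k : ℕ) : ℝ))) * (ρ' / ((L * lev L k : ℕ) : ℝ) ^ 2)
            + L * (L * (ρ₁' / ((L * lev L k : ℕ) : ℝ) ^ 3))) := by
        refine add_le_add (add_le_add ?_ ?_) ?_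
        · exact mul_le_mul hCC (hPR1.trans hpow) (by positivity) (by positivity)
        · exact mul_le_mul hC ((hPR.trans (mul_le_mul hpow hsum (Finset.sum_nonneg fun _ _ => norm_nonneg _) hE.le)))
            (norm_nonneg _) (by positivity)
        · exact hfifth.trans (mul_le_mul_of_nonneg_right hpow (by
            have h0 : 0 ≤ β₁ / ((L * lev L k : ℕ) : ℝ) / ((L * lev L k : ℕ) : ℝ) := by
              have := (norm_nonneg _).trans (hRlip ν (s, i.2)); exact this
            have h1 : 0 ≤ ρ' / ((L * lev L k : ℕ) : ℝ) ^ 2 := (norm_nonneg _).trans (hdist (s, i.2))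
            have h2 : 0 ≤ ρ₁' / ((L * lev L k : ℕ) : ℝ) ^ 3 := (norm_nonneg _).trans (hshift ν (s, i.2))
            positivity))
    _ = Real.exp (α / (lev L k : ℕ)) * (κ₁ / ((lev L k : ℕ) : ℝ) ^ 3 + κ * β₁ / ((lev L k : ℕ) : ℝ) ^ 4
          + 2 * β₁ * ρ' / (L * ((lev L k : ℕ) : ℝ) ^ 4) + ρ₁' / (L * ((lev L k : ℕ) : ℝ) ^ 3)) := by
        rw [hℓ'eq]; field_simp; ring

end Tower

end Summit.QuantumFields.BalabanUV.T4Continuum.B13ReadingsAvgTowerSecond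

end
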